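import Summits.Langlands.Langlands.Theorems.PhantomRMYoshidaResiduallyYoshidaLiftingNoStableLine
import Summits.Langlands.Langlands.Theorems.PhantomRMYoshidaResiduallyYoshidaLiftingNoStableCovector
import Summits.Langlands.Langlands.Theorems.PhantomRMYoshidaResiduallyYoshidaLiftingIrreducibleOfNoStableSubspace
import Summits.Langlands.Langlands.Theorems.PhantomRMYoshidaResiduallyYoshidaLiftingNoStablePlaneSymplectic
import Summits.Langlands.Langlands.Theorems.PhantomRMYoshidaResiduallyYoshidaLiftingDefs
import HarnessLib

/-!
# Every symplectic realiser of a non-trivial class on a non-twist fibre is irreducible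
# (stub `stub_symplecticRealiserIrreducible`, T8) — line `sector-klingen-split`, crux `ResiduallyYoshidaLifting`

Lead prover-line-stmt-Langlands-13639-c4-0 (continuation c4, skeleton rev 7–10, 2026-08-17).  The theorem of this seat on
the REDUCIBLE LOCUS OF THE REALISATION FIBRE of a non-trivial residual class (census F3(i) of the crux strategist, sharpened).

**Theorem (`stub_symplecticRealiserIrreducible`).**  Let `p ≠ 2`, `k` algebraically closed of characteristic `p`,
`red : ℤ̄_p → k` a ring map, `σ̄, σ̄' : Γ_ℚ → GL₂(k)` irreducible and NOT A TWIST PAIR (no `g ∈ GL₂(k)` and scalars `c(x)` with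
`g σ̄(x) g⁻¹ = c(x) σ̄'(x)`; automatic on the generic sector of the split, and on the whole `p ≥ 5` non-corner by p146293 /
p148821), and let `B : Γ_ℚ → M₂(k)` be NOT a coboundary.  If `r : Γ_ℚ → GL₄(ℚ̄_p)` REALISES `B` — some `ℤ̄_p`-integral frame
`rint = P⁻¹ r P` reduces through `red` to a `GL₄(k)`-conjugate of `(σ̄, B; 0, σ̄')` — and `r` is SYMPLECTIC for some multiplier
function `ν` (`IsSymplecticWithMultiplierFun`), then `r` is IRREDUCIBLE.

So on such fibres the `ρ.IsIrreducible` conjuncts in the realiser clauses of the anchor / propagation stubs (R1c-rel, R1d-rel) are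
automatic for `Sh`-points (`shRealiser_isIrreducible`), and — the structural content — the reducible locus of the symplectic
realisation fibre of `[B] ≠ 0`, the object a Skinner–Wiles-type propagation must control, has NO characteristic-`0` point:
Klingen/Borel-type reducibility (a stable line or hyperplane) is excluded by primitive-vector reduction and the invariant-subspace
trichotomy (`stub_noStableLine` p155019, `stub_noStableCovector` p155075), Siegel-type (a stable plane) by stable-plane
saturation over the non-discrete valuation ring `ℤ̄_p`, orientation rigidity, the symplectic block dichotomy, Lagrangian duality
and Brauer–Nesbitt (`stub_noStablePlaneSymplectic` p158301 over p155220 p155179 p155154 p155337 p156235 p156378), endoscopic type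
(decomposable) by `not_blockDiagonal_of_realises_nonsplit` (p146441); the three exclusions give irreducibility by
`stub_irreducible_of_noStableSubspace` (p155087).

Refs (context): Ribet 1976 Prop. 2.1; Bellaïche–Chenevier 2009 §1.5; Skinner–Wiles 1999 §2 (reducible deformations of a non-split
residual representation); Boxer–Calegari–Gee–Pilloni 2021 §2 (symplectic conventions).  Everything used is proved in the tree.
-/

noncomputable section

open scoped MatrixGroups Matrix

set_option linter.dupNamespace false
set_option autoImplicit false

namespace Summit.Langlands.Langlands.Cruxes.ResiduallyYoshidaLifting.SectorKlingenSplit.Fibre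

open Literature.NumberTheory.GaloisRepresentations
open Summit.Langlands.Langlands.Cruxes.ResiduallyYoshidaLifting.YoshidaDivisorSelmerCount (Sh)

/-- **Registered statement `stub_symplecticRealiserIrreducible`** (crux stmt-Langlands-13639, line `sector-klingen-split`,
skeleton rev 7; the lead's assembly): on a NON-TWIST residual pair, every SYMPLECTIC realiser (any multiplier) of a NON-trivial
class `[B]` is irreducible.  Proof: transport a stable line / covector / plane of `r` to the integral frame `P⁻¹ r P` (which is
symplectic for `Pᵀ J P`) and apply the three landed exclusions, then `stub_irreducible_of_noStableSubspace`.
[cite: Ribet1976, Prop. 2.1] [cite: BellaicheChenevier2009, §1.5] -/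
theorem stub_symplecticRealiserIrreducible :
    ∀ (p : ℕ) [Fact p.Prime], p ≠ 2 → ∀ (k : Type) [Field k] [CharP k p] [IsAlgClosed k]
      [TopologicalSpace k] [DiscreteTopology k] (red : Valued.integer (PadicAlgCl p) →+* k)
      (σ σ' : FramedGaloisRep ℚ k 2) (r : FramedGaloisRep ℚ (PadicAlgCl p) 4)
      (B : Field.absoluteGaloisGroup ℚ → Matrix (Fin 2) (Fin 2) k)
      (ν : Field.absoluteGaloisGroup ℚ → PadicAlgCl p),
      σ.toGaloisRep.IsIrreducible → σ'.toGaloisRep.IsIrreducible →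
      (¬ ∃ g : GL (Fin 2) k, ∀ x, ∃ c : k, (g * σ x * g⁻¹).val = c • (σ' x).val) →
      (¬ ∃ X : Matrix (Fin 2) (Fin 2) k, ∀ g, B g = (σ g).val * X - X * (σ' g).val) →
      (∃ (P : GL (Fin 4) (PadicAlgCl p))
        (rint : Field.absoluteGaloisGroup ℚ →* GL (Fin 4) (Valued.integer (PadicAlgCl p))) (h : GL (Fin 4) k),
        (∀ g, Matrix.GeneralLinearGroup.map (Valued.integer (PadicAlgCl p)).subtype (rint g) = P⁻¹ * r g * P) ∧
        (∀ g, (Matrix.GeneralLinearGroup.map red (rint g)).val =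
          h.val * Matrix.reindex finSumFinEquiv finSumFinEquiv
            (Matrix.fromBlocks (σ g).val (B g) 0 (σ' g).val) * (h⁻¹).val)) →
      r.IsSymplecticWithMultiplierFun ν → r.toGaloisRep.IsIrreducible := by
  intro p _ hp k _ _ _ _ _ red σ σ' r B ν hσ hσ' hnt hB hreal hsymp
  obtain ⟨P, rint, h, hP, hred⟩ := hreal
  -- notation: the integral frame over `ℚ̄_p`
  set sub := (Valued.integer (PadicAlgCl p)).subtype with hsubdef
  have hσm : Representation.IsIrreducible ((glStdRepresentation (Fin 2) k).comp σ.toMonoidHom) := hσ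
  have hσ'm : Representation.IsIrreducible ((glStdRepresentation (Fin 2) k).comp σ'.toMonoidHom) := hσ'
  have hframe : ∀ g, (Matrix.GeneralLinearGroup.map sub (rint g)).val = (P⁻¹).val * (r g).val * P.val := by
    intro g
    rw [hP g, Units.val_mul, Units.val_mul]
  have hPP : P.val * (P⁻¹).val = 1 := by rw [← Units.val_mul, mul_inv_cancel, Units.val_one]
  -- (1) no stable line for `r`
  have h1 : ¬ ∃ v : Fin 4 → PadicAlgCl p, v ≠ 0 ∧ ∀ g, ∃ c : PadicAlgCl p, (r.toMonoidHom g).val *ᵥ v = c • v := by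
    rintro ⟨v, hv0, hv⟩
    refine stub_noStableLine p k (Field.absoluteGaloisGroup ℚ) red σ.toMonoidHom σ'.toMonoidHom hσm hσ'm B hB
      (fun g => rint g) h hred ⟨(P⁻¹).val *ᵥ v, ?_, ?_⟩
    · intro h0
      apply hv0
      have := congrArg (fun x => P.val *ᵥ x) h0
      simpa only [Matrix.mulVec_mulVec, hPP, Matrix.one_mulVec, Matrix.mulVec_zero] using this
    · intro g
      obtain ⟨c, hc⟩ := hv g
      refine ⟨c, ?_⟩
      rw [hframe g, ← Matrix.mulVec_mulVec, ← Matrix.mulVec_mulVec, Matrix.mulVec_mulVec _ P.val, hPP,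
        Matrix.one_mulVec]
      change (P⁻¹).val *ᵥ ((r g).val *ᵥ v) = c • ((P⁻¹).val *ᵥ v)
      rw [show (r g).val *ᵥ v = c • v from hc, Matrix.mulVec_smul]
  -- (2) no stable covector for `r`
  have h2 : ¬ ∃ w : Fin 4 → PadicAlgCl p, w ≠ 0 ∧ ∀ g, ∃ c : PadicAlgCl p, w ᵥ* (r.toMonoidHom g).val = c • w := by
    rintro ⟨w, hw0, hw⟩
    refine stub_noStableCovector p k (Field.absoluteGaloisGroup ℚ) red σ.toMonoidHom σ'.toMonoidHom hσm hσ'm B hB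
      (fun g => rint g) h hred ⟨w ᵥ* P.val, ?_, ?_⟩
    · intro h0
      apply hw0
      have := congrArg (fun x => x ᵥ* (P⁻¹).val) h0
      simpa only [Matrix.vecMul_vecMul, hPP, Matrix.vecMul_one, Matrix.zero_vecMul] using this
    · intro g
      obtain ⟨c, hc⟩ := hw g
      refine ⟨c, ?_⟩
      rw [hframe g, ← Matrix.vecMul_vecMul, ← Matrix.vecMul_vecMul, Matrix.vecMul_vecMul _ P.val, hPP,
        Matrix.vecMul_one]
      change (w ᵥ* (r g).val) ᵥ* P.val = c • (w ᵥ* P.val)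
      rw [show w ᵥ* (r g).val = c • w from hc, Matrix.smul_vecMul]
  -- (3) no stable plane for `r`: the frame is symplectic for `Pᵀ J P`
  have h3 : ¬ ∃ M : Matrix (Fin 4) (Fin 2) (PadicAlgCl p), (∀ a : Fin 2 → PadicAlgCl p, M *ᵥ a = 0 → a = 0) ∧
      ∀ g, ∃ T : Matrix (Fin 2) (Fin 2) (PadicAlgCl p), (r.toMonoidHom g).val * M = M * T := by
    rintro ⟨M, hMinj, hM⟩
    obtain ⟨J, hJt, hJu, hJ⟩ := hsymp
    have hJP : ∀ g, (Matrix.GeneralLinearGroup.map sub (rint g)).valᵀ * (P.valᵀ * J * P.val) *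
        (Matrix.GeneralLinearGroup.map sub (rint g)).val = ν g • (P.valᵀ * J * P.val) := by
      intro g
      rw [hframe g]
      have e1 : ((P⁻¹).val * (r g).val * P.val)ᵀ * (P.valᵀ * J * P.val) * ((P⁻¹).val * (r g).val * P.val) =
          P.valᵀ * ((r g).valᵀ * ((P.val * (P⁻¹).val)ᵀ * J * (P.val * (P⁻¹).val)) * (r g).val) * P.val := by
        simp only [Matrix.transpose_mul, Matrix.mul_assoc]
      rw [e1, hPP, Matrix.transpose_one, Matrix.one_mul, Matrix.mul_one, hJ g, Matrix.mul_smul, Matrix.smul_mul]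
    refine stub_noStablePlaneSymplectic p hp k (Field.absoluteGaloisGroup ℚ) red σ.toMonoidHom σ'.toMonoidHom hσm hσ'm
      hnt B hB rint h hred (P.valᵀ * J * P.val) ν ?_ ?_ hJP ⟨(P⁻¹).val * M, ?_, ?_⟩
    · rw [Matrix.transpose_mul, Matrix.transpose_mul, Matrix.transpose_transpose, hJt]
      simp only [Matrix.mul_neg, Matrix.neg_mul, Matrix.mul_assoc]
    · rw [Matrix.det_mul, Matrix.det_mul, Matrix.det_transpose]
      have hPdet : P.val.det ≠ 0 := (Matrix.isUnits_det_units P).ne_zero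
      exact mul_ne_zero (mul_ne_zero hPdet hJu.ne_zero) hPdet
    · intro a ha
      apply hMinj a
      have := congrArg (fun x => P.val *ᵥ x) ha
      simpa only [Matrix.mulVec_mulVec, ← Matrix.mul_assoc, hPP, Matrix.one_mul, Matrix.mulVec_zero] using this
    · intro g
      obtain ⟨T, hT⟩ := hM g
      refine ⟨T, ?_⟩
      rw [hframe g, Matrix.mul_assoc, Matrix.mul_assoc, ← Matrix.mul_assoc P.val, hPP, Matrix.one_mul,
        ← Matrix.mul_assoc]
      change (P⁻¹).val * (r g).val * M = (P⁻¹).val * M * T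
      rw [Matrix.mul_assoc, show (r g).val * M = M * T from hT, Matrix.mul_assoc]
  exact stub_irreducible_of_noStableSubspace (PadicAlgCl p) (Field.absoluteGaloisGroup ℚ) r.toMonoidHom h1 h2 h3

/-- **`Sh`-realisers of a non-trivial class on a non-twist fibre are irreducible** — the form consumed by the anchor /
propagation stubs of the line: `Sh ρ` (symplectic with multiplier `ε⁻¹`, Greenberg-ordinary, residually of Yoshida type) makes the
`ρ.IsIrreducible` conjunct of their realiser clauses automatic. [folklore] -/
theorem shRealiser_isIrreducible {p : ℕ} [Fact p.Prime] (hp : p ≠ 2) {k : Type} [Field k] [CharP k p] [IsAlgClosed k]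
    [TopologicalSpace k] [DiscreteTopology k] (red : Valued.integer (PadicAlgCl p) →+* k)
    (σ σ' : FramedGaloisRep ℚ k 2) (r : FramedGaloisRep ℚ (PadicAlgCl p) 4)
    (B : Field.absoluteGaloisGroup ℚ → Matrix (Fin 2) (Fin 2) k)
    (hσ : σ.toGaloisRep.IsIrreducible) (hσ' : σ'.toGaloisRep.IsIrreducible)
    (hnt : ¬ ∃ g : GL (Fin 2) k, ∀ x, ∃ c : k, (g * σ x * g⁻¹).val = c • (σ' x).val)
    (hB : ¬ ∃ X : Matrix (Fin 2) (Fin 2) k, ∀ g, B g = (σ g).val * X - X * (σ' g).val)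
    (hreal : ∃ (P : GL (Fin 4) (PadicAlgCl p))
        (rint : Field.absoluteGaloisGroup ℚ →* GL (Fin 4) (Valued.integer (PadicAlgCl p))) (h : GL (Fin 4) k),
        (∀ g, Matrix.GeneralLinearGroup.map (Valued.integer (PadicAlgCl p)).subtype (rint g) = P⁻¹ * r g * P) ∧
        (∀ g, (Matrix.GeneralLinearGroup.map red (rint g)).val =
          h.val * Matrix.reindex finSumFinEquiv finSumFinEquiv
            (Matrix.fromBlocks (σ g).val (B g) 0 (σ' g).val) * (h⁻¹).val))
    (hSh : Sh p k red σ σ' r) : r.toGaloisRep.IsIrreducible :=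
  stub_symplecticRealiserIrreducible p hp k red σ σ' r B _ hσ hσ' hnt hB hreal hSh.1

/-- **Non-conjugacy is a special case of non-twist** (`c := 1`): the crux's hypothesis `hnc` follows from the generic
sector's non-twist clause, so the theorem above applies verbatim under `GenericSector`. [folklore] -/
theorem not_conj_of_not_twistPair {k : Type} [Field k] {Γ : Type*} (σ σ' : Γ → GL (Fin 2) k)
    (hnt : ¬ ∃ g : GL (Fin 2) k, ∀ x, ∃ c : k, (g * σ x * g⁻¹).val = c • (σ' x).val) :
    ¬ ∃ g : GL (Fin 2) k, ∀ x, g * σ x * g⁻¹ = σ' x := by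
  rintro ⟨g, hg⟩
  exact hnt ⟨g, fun x => ⟨1, by rw [hg x, one_smul]⟩⟩

end Summit.Langlands.Langlands.Cruxes.ResiduallyYoshidaLifting.SectorKlingenSplit.Fibre

end
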